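import Literature.AnabelianGeometry.EtaleTheta.Discharge.Sec1Thm110ModelChiDeck
import Literature.AnabelianGeometry.EtaleTheta.Discharge.Sec1Prop18ConjEpsPMModelChi
import Literature.AnabelianGeometry.EtaleTheta.SettingModelChiInvClauses
import HarnessLib

/-!
# [EtTh] Thm. 1.10 (i)(ii) at the χ-twisted model FOR A NON-TRIVIAL ISOMORPHISM: `γ :=` the automorphism of `Π^tp_Ċ`
# induced by `ε_±` (`Γ = conj ε_±` on `Π^tp_C`, `γ_X = ι` the twisted inversion) — the K2 deck route with EVERY binder
# discharged at `MuTwoSetting.inversionModelχ`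

S. Mochizuki, *The étale theta function and its Frobenioid-theoretic manifestations*, Publ. RIMS **45** (2009) [EtTh],
§1: Prop. 1.8 p. 28 (γ "induces an isomorphism between the commutative diagrams" of coverings, "the isomorphism
`Π^tp_{Xα} →̃ Π^tp_{Xβ}` induced by γ"), Def. 1.9 p. 29, Thm. 1.10 (i)(ii) pp. 29–30 ("for [an arbitrary] isomorphism
`γ : Π^tp_{Ċα} →̃ Π^tp_{Ċβ}`"); §2 p. 36 (the inversion `ι`), Prop. 2.2 (i) p. 37 (`ι` acts on `Δ̄_Θ` by `+1`)
[cite: MochizukiEtTh2009, Thm 1.10 (ii) p.30]. Layer L2 of the abc-iut cell, seat abc-iut-w5-d140 (gen 4; K2 holder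
lineage), row «K2-NV at a NON-TRIVIAL isomorphism» (STATUS 12:2xZ). Over this lineage's `SettingModelChiMuTwoInversion`
(F8ι: `MuTwoSetting.inversionModelχ`, `PiCInvχ = Π^tp_X ⋊_ι ℤ/2`, `epsPM_conj_inlχ`, `twistedInversion_mem_Xddχ_iff`),
`Discharge/Sec1Thm110ModelChiNV` / `…ModelChiDeck` (the Def. 1.9 datum `tauχ`/`tauInvχ`, `exists_deck_modelχ`,
`exists_coboundary_kappa_mul_kappaInv`, `inl_bPowGfp_conj_sectionχ_left/right`), `Discharge/Sec1Thm110MatchingOfDeck`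
(p430193: `thm110i/ii_of_decompTransport_of_deck`), `Discharge/Sec1Thm110iiOfDecompTransport` (p428966: `transport_conj`),
abc-iut-L2-d1's `SettingModelChiInversionTheta` / `SettingModelChiInvClauses` (`thm16i_twistedInversion_modelχ`, the
quotient-map theta companion `thetaCompanionOfAut ι`, **`transport_etaDdχ`**, **`transport_inflTheta_kumYdd_kummerDataχSec`**
— `ι` fixes `η̈^Θ` and every Kummer class of a constant), abc-iut-w5-d072's `thetaCompanionOfAut`, abc-iut-L2-t10's `modelχ`
riders, abc-iut-L6-d5's `prop15ii_kummerDataχSec` — all consumed BY NAME, nothing restated.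

WHAT. At `M := MuTwoSetting.inversionModelχ p` (`p ≡ 1 (mod 4)` for the Def. 1.9 datum), with part A
(`Discharge/Sec1Prop18ConjEpsPMModelChi`: `conjEpsPMχ` = conjugation by `ε_±` on `Π^tp_C`, an involution restricting to
`ι` and PRESERVING THE COVERINGS — `preservesCoverings_conjEpsPMχ`; `gammaDotCχ` = the inner automorphism of `Π^tp_Ċ` by
`ε_±·ε_μ`, print's `γ`, NOT the identity — `gammaDotCχ_ne_refl`; `Γ` restricts to `γ` up to `c := ε_± ε_μ⁻¹ ε_±⁻¹`):
* **`thm110HypothesisInvχ : Thm110Hypothesis ε_Z ε_Z hC hC E E gammaDotCχ`** with `E := etaleThetaDataχSec p (etaDdχ p)`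
  (abc-iut-L2-d1's genuine theta class), companion `:= thetaCompanionOfAut ι`, and `maps_orbit` PROVED: the transport fixes
  `η̈^Θ` (L2-d1) and carries `conj_σ` to `conj_{ισ}` (`transport_conj`), while `ι(Π^tp_Ẋ) = Π^tp_Ẋ`;
* the K2 binders AT THIS `H`: **`deltaInduced_invχ : Thm110DeltaInduced H (MulEquiv.refl _)`** («the isomorphism
  `K̈^× ⥲ K̈^×` induced by γ» is the IDENTITY: `ι` fixes every inflated Kummer class of a constant — L2-d1),
  `deltaCompat_refl_invχ`, and **r5 `decompTransport_invχ : Thm110DecompTransport H A A` by the SECOND printed alternative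
  «`τ ↦ τ⁻¹`»**: `ι(D_τ) = b^{c₀²}·D_{τ⁻¹}·b^{−c₀²}` where `c₀` is the coboundary constant of `κ_{√−1}·κ_{(√−1)⁻¹}`
  (`Discharge/Sec1Thm110ModelChiDeck`), and `b^{c₀²} ∈ Π^tp_Ẍ` (EVEN `b`-parity) — so γ carries the decomposition group of
  `τ` to a `Π^tp_Ẋ`-conjugate of that of `τ⁻¹`, exactly the case distinction of print's proof of Thm. 1.10 (ii);
* **`inversionModelχ_thm110i_and_ii_invχ : Thm110i H A A ∧ Thm110ii H A A`** by the deck route p430193 — EVERY binder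
  (`Thm110DeltaInduced`, `Thm110DeltaCompat`, r5, deck α/β from `exists_deck_modelχ`, `Prop15ii` from abc-iut-L6-d5) is a
  THEOREM here, and γ is NOT the identity (`gammaDotCχ_ne_refl`); headline
  `MuTwoSetting.exists_kummer_model_thm110_nontrivial_iso`.

HONEST FRAMING: SEMI-SYNTHETIC model (the χ-twisted root; not the tempered `π₁` of a curve) — non-vacuity / consistency
evidence for the typed interface ONLY; `γ` is an inner automorphism of `Π^tp_Ċ` coming from `Π^tp_C` (print allows arbitrary
isomorphisms); nothing of [EtTh] is asserted; a FACT row is an assumption label; typed ≠ proved; no side is taken on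
[IUTchIII] Cor. 3.12. Definitions (class (b) constructions over FROZEN records, no instance, no `Prop` fact): `companionInvχ`,
`etaleThetaDataχI`, `anchoredStandardDataχI`, `thm110HypothesisInvχ`.
-/

noncomputable section

namespace Literature.AnabelianGeometry.EtaleTheta.SettingModel

open Literature.AnabelianGeometry.SemiGraphs Literature.AnabelianGeometry.AbsoluteAnabelian
open _root_.Topology _root_.Function

variable (p : ℕ) [Fact p.Prime]
/-! ### §0. The actors: the theta companion of `ι`, the data read over `MuTwoSetting.inversionModelχ` -/

/-- Its quotient-map theta companion `ι^Θ` (abc-iut-w5-d072's `thetaCompanionOfAut`; `+1` on `Δ_Θ`).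
[cite: MochizukiEtTh2009, Thm 1.6 (ii) p.24] -/
abbrev companionInvχ :
    ThetaSetting.ThetaCompanion (Dα := ThetaSetting.modelχ p) (Dβ := ThetaSetting.modelχ p) (invχ p) :=
  (ThetaSetting.modelχ p).thetaCompanionOfAut (invχ p) (map_deltaTemp_twistedInversion_modelχ p)
    (isQuotientMap_toTheta_modelχ p)

/-- abc-iut-L2-t6's `etaleThetaDataχSec p η` read over `MuTwoSetting.inversionModelχ p`. [cite: MochizukiEtTh2009, Prop 1.3 p.20] -/
abbrev etaleThetaDataχI (η : (ThetaSetting.modelχ p).H1 (ThetaSetting.modelχ p).GtpYdd) :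
    (MuTwoSetting.inversionModelχ p).toThetaSetting.EtaleThetaData :=
  etaleThetaDataχSec p η

/-- **Def. 1.9's anchored standard datum over `MuTwoSetting.inversionModelχ`** (`p ≡ 1 (mod 4)`; the points
`τ^{±1} := anchoredPointχ (√−1)^{±1}` of `Discharge/Sec1Thm110ModelChiNV`). DEFINED. [cite: MochizukiEtTh2009, Def 1.9 p.29] -/
def anchoredStandardDataχI (hp : p % 4 = 1) (η : (ThetaSetting.modelχ p).H1 (ThetaSetting.modelχ p).GtpYdd) :
    (MuTwoSetting.inversionModelχ p).AnchoredStandardData (etaleThetaDataχSec p η).toKummerData := by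
  delta etaleThetaDataχSec ThetaSetting.KummerData.etaleThetaDataOfClass
  exact MuTwoSetting.anchoredStandardDataOfPoints (M := MuTwoSetting.inversionModelχ p) (sqrtNegOneχ p hp)
    (sqrtNegOneχ_mem_K p hp) (sqrtNegOneχ_sq p hp) (tauχ p hp) (tauInvχ p hp) rfl rfl

/-- `Prop15ii` of the datum (abc-iut-L6-d5's theorem, retyped). [cite: MochizukiEtTh2009, Prop 1.5 (ii) p.23] -/
theorem prop15ii_etaleThetaDataχI (η : (ThetaSetting.modelχ p).H1 (ThetaSetting.modelχ p).GtpYdd) :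
    ThetaSetting.Prop15ii (etaleThetaDataχSec p η).toKummerData (MuTwoSetting.inversionModelχ_compat p) := by
  delta etaleThetaDataχSec ThetaSetting.KummerData.etaleThetaDataOfClass
  exact prop15ii_kummerDataχSec p _

/-- The DECK RELATION for the datum (this lineage's `exists_deck_modelχ`, retyped). [cite: MochizukiEtTh2009, Def 1.9 p.29] -/
theorem exists_deck_anchoredStandardDataχI (hp : p % 4 = 1)
    (η : (ThetaSetting.modelχ p).H1 (ThetaSetting.modelχ p).GtpYdd) :
    ∃ ε : (MuTwoSetting.inversionModelχ p).PiTemp, (MuTwoSetting.inversionModelχ p).toZ ε = 1 ∧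
      (anchoredStandardDataχI p hp η).tauInv.Dpt =
        (anchoredStandardDataχI p hp η).tau.Dpt.comap (MulAut.conj ε).toMonoidHom :=
  exists_deck_modelχ p hp
/-! ### §4. The hypothesis of Thm. 1.10 for `γ` at the model -/

/-- `inclX σ ∈ Π^tp_Ẋ ↔ inclX (ι σ) ∈ Π^tp_Ẋ` (`Γ(Π^tp_Ẋ) = Π^tp_Ẋ`). [cite: MochizukiEtTh2009, Prop 1.8 p.28] -/
theorem inclInvχ_invχ_mem_dotX_iff (σ : PiTpχ p) :
    inclInvχ p (invχ p σ) ∈ (MuTwoSetting.inversionModelχ p).dotX (epsZInvχ p) ↔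
      inclInvχ p σ ∈ (MuTwoSetting.inversionModelχ p).dotX (epsZInvχ p) := by
  have hmap := (preservesCoverings_conjEpsPMχ p).map_dotX
  constructor
  · intro h
    have h' : conjEpsPMχ p (inclInvχ p (invχ p σ)) ∈
        ((MuTwoSetting.inversionModelχ p).dotX (epsZInvχ p)).map (conjEpsPMχ p).toMulEquiv.toMonoidHom := ⟨_, h, rfl⟩
    rw [hmap, conjEpsPMχ_inclInvχ] at h'
    change inclInvχ p (twistedInversion (chi p) (twistedInversion (chi p) σ)) ∈ _ at h'
    rwa [twistedInversion_twistedInversion] at h'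
  · intro h
    have h' : conjEpsPMχ p (inclInvχ p σ) ∈
        ((MuTwoSetting.inversionModelχ p).dotX (epsZInvχ p)).map (conjEpsPMχ p).toMulEquiv.toMonoidHom := ⟨_, h, rfl⟩
    rwa [hmap, conjEpsPMχ_inclInvχ] at h'

/-- **The hypothesis of Thm. 1.10 HOLDS at the model for the non-trivial `γ`** — `Ċ` of type `(1, μ₂)±` (admissible
`ε_Z`), `Γ := conj ε_±` preserving the coverings and restricting to `γ` up to the inner automorphism by
`c := ε_± ε_μ⁻¹ ε_±⁻¹`, the induced `γ_X = ι` with Thm. 1.6 (i) and its theta companion, and «`γ_X` maps `η̈^{Θ,Z} ↦ η̈^{Θ,Z}`»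
(the transport FIXES `η̈^Θ` — abc-iut-L2-d1 — and carries `Π^tp_Ẋ`-conjugates to `Π^tp_Ẋ`-conjugates). DEFINED (data: `Γ`,
`γ_X`, companion). [cite: MochizukiEtTh2009, Thm 1.10 p.29] -/
def thm110HypothesisInvχ :
    Thm110Hypothesis (Mα := MuTwoSetting.inversionModelχ p) (Mβ := MuTwoSetting.inversionModelχ p)
      (epsZInvχ p) (epsZInvχ p) (MuTwoSetting.inversionModelχ_compat p) (MuTwoSetting.inversionModelχ_compat p)
      (etaleThetaDataχI p (etaDdχ p)) (etaleThetaDataχI p (etaDdχ p)) (gammaDotCχ p) where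
  admα := MuTwoSetting.inversionModelχ_isAdmissibleEpsZ p
  admβ := MuTwoSetting.inversionModelχ_isAdmissibleEpsZ p
  Γ := conjEpsPMχ p
  preserves := preservesCoverings_conjEpsPMχ p
  restricts := by
    refine ⟨epsPMInvχ p * ((MuTwoSetting.inversionModelχ p).epsMu)⁻¹ * (epsPMInvχ p)⁻¹, fun x => ?_⟩
    change epsPMInvχ p * (x : PiCInvχ p) * (epsPMInvχ p)⁻¹ =
      epsPMInvχ p * ((MuTwoSetting.inversionModelχ p).epsMu)⁻¹ * (epsPMInvχ p)⁻¹ *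
        (epsPMInvχ p * (MuTwoSetting.inversionModelχ p).epsMu * x *
          (epsPMInvχ p * (MuTwoSetting.inversionModelχ p).epsMu)⁻¹) *
        (epsPMInvχ p * ((MuTwoSetting.inversionModelχ p).epsMu)⁻¹ * (epsPMInvχ p)⁻¹)⁻¹
    group
  γX := invχ p
  γX_spec x := (conjEpsPMχ_inclInvχ p x).symm
  thm16i := thm16i_twistedInversion_modelχ p
  companion := companionInvχ p
  maps_orbit y := by
    haveI := (MuTwoSetting.inversionModelχ_compat p).GtpYdd_normal
    have hT := transport_etaDdχ p (companionInvχ p)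
    constructor
    · rintro ⟨σ, hσ, rfl⟩
      refine ⟨ContH1.conj (ThetaSetting.modelχ p).toTheta (ThetaSetting.modelχ p).DeltaTheta (invχ p σ) (etaDdχ p),
        ⟨invχ p σ, (inclInvχ_invχ_mem_dotX_iff p σ).mpr hσ, rfl⟩, ?_⟩
      change ContH1.conj _ _ σ (etaDdχ p) = ThetaSetting.transport (companionInvχ p) (thm16i_twistedInversion_modelχ p)
        (ContH1.conj _ _ (invχ p σ) (etaDdχ p))
      rw [ThetaSetting.transport_conj, hT]
      change _ = ContH1.conj _ _ (twistedInversion (chi p) (twistedInversion (chi p) σ)) (etaDdχ p)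
      rw [twistedInversion_twistedInversion]
    · rintro ⟨_, ⟨σ, hσ, rfl⟩, rfl⟩
      refine ⟨invχ p σ, (inclInvχ_invχ_mem_dotX_iff p σ).mpr hσ, ?_⟩
      change ThetaSetting.transport (companionInvχ p) (thm16i_twistedInversion_modelχ p)
        (ContH1.conj _ _ σ (etaDdχ p)) = ContH1.conj _ _ (invχ p σ) (etaDdχ p)
      rw [ThetaSetting.transport_conj, hT]
      rfl

/-- The extension `Γ` of the hypothesis is `conj ε_±`, and `γ_X = ι`. [cite: MochizukiEtTh2009, Prop 1.8 p.28] -/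
theorem thm110HypothesisInvχ_Γ_γX :
    (thm110HypothesisInvχ p).Γ = conjEpsPMχ p ∧ (thm110HypothesisInvχ p).γX = invχ p := ⟨rfl, rfl⟩

/-! ### §5. The K2 binders at this hypothesis -/

/-- **«The isomorphism `K̈^× ⥲ K̈^×` induced by `γ`» is the IDENTITY**: `Thm110DeltaInduced H (refl)` — the transport along
`(ι, ι^Θ)` of the inflated Kummer class of every constant is itself (abc-iut-L2-d1's `transport_inflTheta_kumYdd_kummerDataχSec`:
the cocycle factors through `aug`, `aug ∘ ι = aug`, `ι^Θ = +1` on `Δ_Θ`). [cite: MochizukiEtTh2009, Thm 1.10 (ii) p.30] -/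
theorem deltaInduced_invχ : Thm110DeltaInduced (thm110HypothesisInvχ p) (MulEquiv.refl _) := fun a => by
  change ThetaSetting.transport (companionInvχ p) (thm16i_twistedInversion_modelχ p)
      ((ThetaSetting.modelχ p).inflTheta (ThetaSetting.modelχ p).GtpYdd
        ((kummerDataχSec p).kumYdd ((kummerDataχSec p).toKddHat a))) =
    (ThetaSetting.modelχ p).inflTheta (ThetaSetting.modelχ p).GtpYdd
      ((kummerDataχSec p).kumYdd ((kummerDataχSec p).toKddHat a))
  exact transport_inflTheta_kumYdd_kummerDataχSec p (companionInvχ p) _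

/-- `Thm110DeltaCompat` for the identity (units, order and `±1` trivially preserved). [cite: MochizukiEtTh2009, Thm 1.10 (i) p.29] -/
theorem deltaCompat_refl_invχ :
    Thm110DeltaCompat (Mα := MuTwoSetting.inversionModelχ p) (Mβ := MuTwoSetting.inversionModelχ p)
      (MulEquiv.refl (↥(MuTwoSetting.inversionModelχ p).Kdd)ˣ) :=
  ⟨fun _ => Iff.rfl, fun _ _ => Iff.rfl, fun _ => Iff.rfl⟩

/-- The algebra of the r5 computation: from `k·k' = χ(c₀)/c₀`, `k⁻² = c₀²·k'²·χ(c₀²)⁻¹`. [folklore] -/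
private theorem r5_algebra {G : Type*} [CommGroup G] (χ : G →* G) {k k' c₀ : G} (hA : k * k' = χ c₀ * c₀⁻¹) :
    (k * k)⁻¹ = c₀ * c₀ * (k' * k') * (χ (c₀ * c₀))⁻¹ := by
  have hk : k = χ c₀ * c₀⁻¹ * k'⁻¹ := eq_mul_inv_of_mul_eq hA
  rw [map_mul, hk]
  apply Additive.ofMul.injective
  simp only [ofMul_mul, ofMul_inv]
  abel

/-- **`ι` carries the twisted section of `τ` to a `Π^tp_Ẍ`-conjugate of that of `τ⁻¹`**: with `c₀` the coboundary constant
of `κ_{√−1}·κ_{(√−1)⁻¹}`, `ι(s_{√−1}(σ)) = b^{c₀²} · s_{(√−1)⁻¹}(σ) · b^{−c₀²}` for every `σ`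
(`ι_Γ(b^{2κ}) = b^{−2κ}` and `−2κ_u = 2κ_{u'} − 2(χ−1)c₀`). [cite: MochizukiEtTh2009, Thm 1.10 (ii) p.30] -/
theorem exists_invχ_sectionOfUnitχ_conj (hp : p % 4 = 1) :
    ∃ c₀ : ZH, ∀ σ : GQp p,
      invχ p (sectionOfUnitχ p (sqrtNegOneUnitχ p hp) σ) =
        (SemidirectProduct.inl (bPowGfp (c₀ * c₀)) : PiTpχ p) * sectionOfUnitχ p (sqrtNegOneInvUnitχ p hp) σ *
          (SemidirectProduct.inl (bPowGfp (c₀ * c₀)))⁻¹ := by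
  obtain ⟨c₀, hc₀⟩ := exists_coboundary_kappa_mul_kappaInv p hp
  refine ⟨c₀, fun σ => ?_⟩
  rw [sectionOfUnitχ_def, sectionOfUnitχ_def]
  refine SemidirectProduct.ext ?_ ?_
  · rw [inl_bPowGfp_conj_sectionχ_left, invχ, twistedInversionTop_apply, twistedInversion_left, sectionχ_left,
      gfpInv_bPowGfp_eq, Pi.mul_apply, Pi.mul_apply]
    congr 1
    letI : CommGroup ZH := { (inferInstance : Group ZH) with mul_comm := ZHatCompletion.mul_comm }
    exact r5_algebra (chi p σ).toMonoidHom (hc₀ σ)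
  · rw [inl_bPowGfp_conj_sectionχ_right, invχ, twistedInversionTop_apply, twistedInversion_right, sectionχ_right]

/-- `b^{t·t} ∈ Π^tp_Ẍ` (its `b`-parity `2·t` is even; `a`-parity `0`). [cite: MochizukiEtTh2009, Def 1.7 p.27] -/
theorem inl_bPowGfp_mul_self_mem_Xddχ (t : ZH) :
    (SemidirectProduct.inl (bPowGfp (t * t)) : PiTpχ p) ∈ Xddχ p := by
  rw [map_mul, map_mul]
  exact mul_self_mem_Xddχ p _

/-- **The typed row r5 `Thm110DecompTransport H A A` HOLDS for `γ` at the model, by the SECOND printed alternative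
«`D_{τα} ↦` (a `Π^tp_Ẋ`-conjugate of) `D_{τβ⁻¹}`»** with conjugator `inclX (b^{c₀²}) ∈ inclX(Π^tp_Ẍ) ≤ Π^tp_Ẋ`.
[cite: MochizukiEtTh2009, Thm 1.10 (ii) p.30] -/
theorem decompTransport_invχ (hp : p % 4 = 1) :
    Thm110DecompTransport (thm110HypothesisInvχ p) (anchoredStandardDataχI p hp (etaDdχ p)).toStandardData
      (anchoredStandardDataχI p hp (etaDdχ p)).toStandardData := by
  obtain ⟨c₀, hc₀⟩ := exists_invχ_sectionOfUnitχ_conj p hp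
  refine ⟨SemidirectProduct.inl (bPowGfp (c₀ * c₀)), ?_, Or.inr ?_⟩
  · exact Subgroup.mem_sup_left ⟨_, inl_bPowGfp_mul_self_mem_Xddχ p c₀, rfl⟩
  · change ((ThetaSetting.modelχ p).GKdd.map (sectionOfUnitχ p (sqrtNegOneUnitχ p hp))).map
        (invχ p).toMulEquiv.toMonoidHom =
      ((ThetaSetting.modelχ p).GKdd.map (sectionOfUnitχ p (sqrtNegOneInvUnitχ p hp))).map
        (MulAut.conj (SemidirectProduct.inl (bPowGfp (c₀ * c₀)) : PiTpχ p)).toMonoidHom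
    rw [Subgroup.map_map, Subgroup.map_map]
    congr 1
    exact MonoidHom.ext fun σ => hc₀ σ

/-! ### §6. Thm. 1.10 (i)(ii) for `γ` at the model — every binder discharged -/

/-- **[EtTh] Thm. 1.10 (i) AND (ii) HOLD at `MuTwoSetting.inversionModelχ` for the NON-TRIVIAL `γ` (inner by `ε_±ε_μ` on
`Π^tp_Ċ`, `γ_X = ι`)**, `p ≡ 1 (mod 4)`, at the anchored Def. 1.9 datum and abc-iut-L2-d1's theta class `etaDdχ` — by this
lineage's deck route p430193 with ALL binders theorems: `Thm110DeltaInduced H id` (§5), `Thm110DeltaCompat id`, r5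
`Thm110DecompTransport H A A` (§5, second alternative), the deck relations (`exists_deck_modelχ`) and `Prop15ii`
(abc-iut-L6-d5). [cite: MochizukiEtTh2009, Thm 1.10 (ii) p.30] -/
theorem inversionModelχ_thm110i_and_ii_invχ (hp : p % 4 = 1) :
    Thm110i (thm110HypothesisInvχ p) (anchoredStandardDataχI p hp (etaDdχ p)).toStandardData
        (anchoredStandardDataχI p hp (etaDdχ p)).toStandardData ∧
      Thm110ii (thm110HypothesisInvχ p) (anchoredStandardDataχI p hp (etaDdχ p)).toStandardData
        (anchoredStandardDataχI p hp (etaDdχ p)).toStandardData := by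
  obtain ⟨ε, hε, hD⟩ := exists_deck_anchoredStandardDataχI p hp (etaDdχ p)
  exact ⟨thm110i_of_decompTransport_of_deck (thm110HypothesisInvχ p) _ _ (prop15ii_etaleThetaDataχI p (etaDdχ p))
      (prop15ii_etaleThetaDataχI p (etaDdχ p)) (MulEquiv.refl _) (deltaInduced_invχ p) (deltaCompat_refl_invχ p)
      (decompTransport_invχ p hp) hε hD hε hD,
    thm110ii_of_decompTransport_of_deck (thm110HypothesisInvχ p) _ _ (prop15ii_etaleThetaDataχI p (etaDdχ p))
      (prop15ii_etaleThetaDataχI p (etaDdχ p)) (MulEquiv.refl _) (deltaInduced_invχ p)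
      (decompTransport_invχ p hp) hε hD hε hD⟩

/-- For comparison, **the identity isomorphism at the same model and datum** (this lineage's `thm110i_and_ii_refl`,
p429827, now at `MuTwoSetting.inversionModelχ`; any class `η̈`). [cite: MochizukiEtTh2009, Thm 1.10 (i) p.29] -/
theorem inversionModelχ_thm110i_and_ii_refl (hp : p % 4 = 1)
    (η : (ThetaSetting.modelχ p).H1 (ThetaSetting.modelχ p).GtpYdd) :
    ∃ H : Thm110Hypothesis (Mα := MuTwoSetting.inversionModelχ p) (Mβ := MuTwoSetting.inversionModelχ p)
        (epsZInvχ p) (epsZInvχ p) (MuTwoSetting.inversionModelχ_compat p) (MuTwoSetting.inversionModelχ_compat p)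
        (etaleThetaDataχI p η) (etaleThetaDataχI p η) (ContinuousMulEquiv.refl _),
      Thm110i H (anchoredStandardDataχI p hp η).toStandardData (anchoredStandardDataχI p hp η).toStandardData ∧
        Thm110ii H (anchoredStandardDataχI p hp η).toStandardData (anchoredStandardDataχI p hp η).toStandardData :=
  (MuTwoSetting.inversionModelχ p).thm110i_and_ii_refl (MuTwoSetting.inversionModelχ_isAdmissibleEpsZ p)
    (MuTwoSetting.inversionModelχ_compat p) (etaleThetaDataχI p η) (anchoredStandardDataχI p hp η)
    (prop15ii_etaleThetaDataχI p η)

/-- **CENSUS HEADLINE — the K2 pipeline at a non-identity isomorphism.** For `p ≡ 1 (mod 4)` there are a Def. 1.7 setting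
`M` (guard `IsEtThOrigin`, admissible `ε_Z`, Kummer data), étale-theta data `E` with non-trivial class, an ANCHORED standard
datum `A`, and an isomorphism `γ : Π^tp_Ċ ⥲ Π^tp_Ċ` which is NOT the identity, together with `H : Thm110Hypothesis ε_Z ε_Z hC hC E E γ`
whose induced `γ_X` is a nontrivial involution of `Π^tp_X`, such that `Thm110i H A A ∧ Thm110ii H A A`.
[cite: MochizukiEtTh2009, Thm 1.10 p.29] -/
theorem _root_.Literature.AnabelianGeometry.EtaleTheta.MuTwoSetting.exists_kummer_model_thm110_nontrivial_iso
    (hp : p % 4 = 1) :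
    ∃ (M : MuTwoSetting p) (εZ : M.GtpC) (_ : M.IsAdmissibleEpsZ εZ) (hC : M.toThetaSetting.Compat)
      (E : M.toThetaSetting.EtaleThetaData) (A : M.AnchoredStandardData E.toKummerData)
      (γ : ↥(M.dotC εZ) ≃ₜ* ↥(M.dotC εZ)) (H : Thm110Hypothesis εZ εZ hC hC E E γ),
      M.toThetaSetting.IsEtThOrigin ∧ E.etaDd ≠ 1 ∧ γ ≠ ContinuousMulEquiv.refl _ ∧
        H.γX ≠ ContinuousMulEquiv.refl _ ∧ (∀ x, H.γX (H.γX x) = x) ∧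
        Thm110i H A.toStandardData A.toStandardData ∧ Thm110ii H A.toStandardData A.toStandardData := by
  obtain ⟨h1, h2⟩ := inversionModelχ_thm110i_and_ii_invχ p hp
  exact ⟨MuTwoSetting.inversionModelχ p, epsZInvχ p, MuTwoSetting.inversionModelχ_isAdmissibleEpsZ p,
    MuTwoSetting.inversionModelχ_compat p, etaleThetaDataχI p (etaDdχ p), anchoredStandardDataχI p hp (etaDdχ p),
    gammaDotCχ p, thm110HypothesisInvχ p, MuTwoSetting.inversionModelχ_isEtThOrigin p, etaDdχ_ne_one p,
    gammaDotCχ_ne_refl p, (twistedInversion_involutive_ne_refl_modelχ p).2,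
    (twistedInversion_involutive_ne_refl_modelχ p).1, h1, h2⟩

end Literature.AnabelianGeometry.EtaleTheta.SettingModel

end
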